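import Mathlib.RingTheory.LaurentSeries
import Mathlib.RingTheory.PowerSeries.Derivative
import Mathlib.LinearAlgebra.Dimension.Constructions
import Mathlib.LinearAlgebra.FiniteDimensional.Defs
import Literature.RingTheory.PowerSeries.LaurentSeriesDerivation
import HarnessLib

/-!
# Linear differential equations over `K⸨X⸩`: Wronskian descent, `dim_K Sol ≤ order`, and power-series bases

`Literature/RingTheory/PowerSeries/LaurentLinearODESolutions.lean` — everything PROVED. Over the
differential field `K⸨X⸩` (`K` a field of characteristic zero, `D = d/dX` = Mathlib's
`LaurentSeries.derivative`, a derivation by `LaurentSeriesDerivation.lean`; constants `K`,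
`laurent_eq_C_of_derivative_eq_zero`):

* §2 `linearIndependent_laurent_of_const`, `card_le_of_const_indep_laurent` — the Wronskian
  descent for a `K`-subspace `V ⊆ K⸨X⸩ᶥ` closed under `d` up to a `K⸨X⸩`-linear map
  (`K`-independent ⟹ `K⸨X⸩`-independent; hence at most `card ι` independent members) — the field
  version of the tree's `Literature/Barriers/Schanuel/EFunctionValuesAtAlgebraicPointsWronski.lean`
  (there over `K⟦X⟧`, Baker Ch. 11 §2);
* §3 `mem_span_of_laurentOp_eq_zero` — for `Λ = ∑_{k≤m} qₖ Dᵏ` with `qₘ ≠ 0` (`laurentOp`), `m`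
  `K`-linearly independent solutions span ALL solutions in `K⸨X⸩` (apply §2 to the jets
  `(u, u′, …, u⁽ᵐ⁻¹⁾)`, `laurentJetMap`): the `K`-space of solutions has dimension `≤ m`;
  `exists_powerSeries_of_laurentOp_eq_zero` — in particular, if those `m` solutions are POWER
  SERIES, every Laurent-series solution is a power series: the formal content of "a basis of
  holomorphic solutions at a point excludes solutions with a pole there", used to pass from
  André's theorem (a basis of holomorphic solutions of an `E`-operator at `z = 1`) to the
  hypothesis of `Literature/NumberTheory/Transcendental/FischlerRivoalCorollary1OfAndre.lean`.

Definitions: `dvecL` (componentwise derivative), `laurentOp`, `laurentJetMap`. All [folklore] (e.g.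
M. van der Put, M. Singer, *Galois theory of linear differential equations*, Lemma 1.12).
-/

noncomputable section

open HahnSeries LaurentSeries PowerSeries

namespace Literature.RingTheory.PowerSeries


variable {K : Type*} [Field K] [CharZero K]

/-! ### 1. Constants of `K⸨X⸩` -/

/-- In characteristic zero a Laurent series with zero derivative is constant. [folklore] -/
theorem laurent_eq_C_of_derivative_eq_zero {f : K⸨X⸩} (h : LaurentSeries.derivative K f = 0) :
    f = HahnSeries.C (f.coeff 0) := by
  ext n
  by_cases hn : n = 0
  · subst hn; simp
  · have := congrArg (fun g => HahnSeries.coeff g (n - 1)) h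
    simp only [laurent_coeff_derivative, sub_add_cancel, HahnSeries.coeff_zero] at this
    rw [zsmul_eq_mul, mul_eq_zero] at this
    rcases this with h0 | h0
    · exfalso; apply hn; exact_mod_cast h0
    · rw [h0, HahnSeries.C_apply, HahnSeries.coeff_single_of_ne hn]

omit [CharZero K] in
/-- The derivative of the constant `1` vanishes. [folklore] -/
theorem laurent_derivative_one : LaurentSeries.derivative K (1 : K⸨X⸩) = 0 := by
  have h := derivative_mul (R := K) (1 : K⸨X⸩) 1
  rw [mul_one, one_mul, mul_one] at h
  -- `D 1 = D 1 + D 1`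
  have : LaurentSeries.derivative K (1 : K⸨X⸩) + LaurentSeries.derivative K (1 : K⸨X⸩)
      - LaurentSeries.derivative K (1 : K⸨X⸩) = 0 := by rw [← h, sub_self]
  simpa using this

/-! ### 2. Wronskian descent over the differential field `K⸨X⸩` -/

section Descent

variable {ι : Type*}

/-- Componentwise derivative of a vector of Laurent series. [folklore] -/
def dvecL (Y : ι → K⸨X⸩) : ι → K⸨X⸩ :=
  fun i => LaurentSeries.derivative K (Y i)

omit [CharZero K] in
/-- Leibniz rule for `dvecL` on a `K⸨X⸩`-combination. [folklore] -/
theorem dvecL_sum_smul {m : ℕ} (c : Fin m → K⸨X⸩) (Y : Fin m → ι → K⸨X⸩) :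
    dvecL (∑ l, c l • Y l) =
      ∑ l, (LaurentSeries.derivative K (c l)) • Y l + ∑ l, c l • dvecL (Y l) := by
  funext i
  simp only [dvecL, Finset.sum_apply, Pi.add_apply, Pi.smul_apply, smul_eq_mul, map_sum,
    derivative_mul, ← Finset.sum_add_distrib]

/-- **Wronskian descent over `K⸨X⸩`**: let `V ⊆ K⸨X⸩ᶥ` be a `K`-subspace with `dY = L(Y)` for
`Y ∈ V`, `L` linear over `K⸨X⸩`. A family in `V` which is linearly independent over the constants
`K` is linearly independent over `K⸨X⸩` (normalise a shortest relation to have a coefficient `1`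
and differentiate it). [folklore] -/
theorem linearIndependent_laurent_of_const (V : Submodule K (ι → K⸨X⸩))
    (L : (ι → K⸨X⸩) →ₗ[K⸨X⸩] (ι → K⸨X⸩)) (hV : ∀ Y ∈ V, dvecL Y = L Y) {m : ℕ}
    (Y : Fin m → ι → K⸨X⸩) (hYV : ∀ l, Y l ∈ V) (hK : LinearIndependent K Y) :
    LinearIndependent K⸨X⸩ Y := by
  classical
  suffices key : ∀ (s : ℕ) (c : Fin m → K⸨X⸩),
      (Finset.univ.filter fun l => c l ≠ 0).card ≤ s → ∑ l, c l • Y l = 0 → c = 0 by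
    rw [Fintype.linearIndependent_iff]
    intro c hc l
    exact congr_fun (key _ c le_rfl hc) l
  intro s
  induction s with
  | zero =>
    intro c hs _
    funext l
    by_contra h
    have : l ∈ Finset.univ.filter fun l => c l ≠ 0 := Finset.mem_filter.mpr ⟨Finset.mem_univ _, h⟩
    exact absurd (Finset.card_pos.mpr ⟨l, this⟩) (by omega)
  | succ s ih =>
    intro c hs hrel
    by_contra hc0
    obtain ⟨l₀, hcl₀⟩ : ∃ l₀, c l₀ ≠ 0 := by
      by_contra h
      exact hc0 (funext fun l => not_not.mp (not_exists.mp h l))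
    have hl₀S : l₀ ∈ Finset.univ.filter fun l => c l ≠ 0 :=
      Finset.mem_filter.mpr ⟨Finset.mem_univ _, hcl₀⟩
    -- normalise: coefficient `1` at `l₀`
    set c'' : Fin m → K⸨X⸩ := fun l => (c l₀)⁻¹ * c l with hc''
    have hc''l₀ : c'' l₀ = 1 := by simp [hc'', hcl₀]
    have hc''zero : ∀ l, c l = 0 → c'' l = 0 := fun l hl => by simp [hc'', hl]
    have hrel'' : ∑ l, c'' l • Y l = 0 := by
      have : ∑ l, c'' l • Y l = (c l₀)⁻¹ • ∑ l, c l • Y l := by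
        rw [Finset.smul_sum]
        exact Finset.sum_congr rfl fun l _ => by rw [← mul_smul]
      rw [this, hrel, smul_zero]
    -- differentiate the normalised relation
    have hrel''' : ∑ l, (LaurentSeries.derivative K (c'' l)) • Y l = 0 := by
      have hd := dvecL_sum_smul c'' Y
      rw [hrel''] at hd
      have hd0 : dvecL (0 : ι → K⸨X⸩) = 0 := by funext i; simp [dvecL]
      rw [hd0] at hd
      have hL : ∑ l, c'' l • dvecL (Y l) = 0 := by
        simp_rw [hV _ (hYV _), ← map_smul, ← map_sum, hrel'', map_zero]
      have h3 : ∑ l, (LaurentSeries.derivative K (c'' l)) • Y l + ∑ l, c'' l • dvecL (Y l) = 0 :=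
        hd.symm
      rwa [hL, add_zero] at h3
    have hsupp : (Finset.univ.filter fun l => LaurentSeries.derivative K (c'' l) ≠ 0).card ≤ s := by
      have hsub : (Finset.univ.filter fun l => LaurentSeries.derivative K (c'' l) ≠ 0) ⊆
          (Finset.univ.filter fun l => c l ≠ 0).erase l₀ := by
        intro l hl
        simp only [Finset.mem_filter, Finset.mem_univ, true_and] at hl
        rw [Finset.mem_erase]
        refine ⟨?_, ?_⟩
        · rintro rfl
          rw [hc''l₀] at hl
          exact hl laurent_derivative_one
        · simp only [Finset.mem_filter, Finset.mem_univ, true_and]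
          intro h0
          exact hl (by rw [hc''zero l h0, map_zero])
      have := Finset.card_le_card hsub
      rw [Finset.card_erase_of_mem hl₀S] at this
      omega
    have hzero := ih (fun l => LaurentSeries.derivative K (c'' l)) hsupp hrel'''
    have hconst : ∀ l, c'' l = HahnSeries.C ((c'' l).coeff 0) := fun l =>
      laurent_eq_C_of_derivative_eq_zero (congr_fun hzero l)
    have hKrel : ∑ l, ((c'' l).coeff 0) • Y l = 0 := by
      have : ∀ l, ((c'' l).coeff 0) • Y l = c'' l • Y l := by
        intro l
        funext i
        rw [Pi.smul_apply, Pi.smul_apply, smul_eq_mul]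
        conv_rhs => rw [hconst l]
        rw [HahnSeries.C_mul_eq_smul]
      simp_rw [this]
      exact hrel''
    have := (Fintype.linearIndependent_iff.mp hK) _ hKrel l₀
    rw [hc''l₀] at this
    simp at this

/-- Consequence: a `K`-independent family in such a `V` has at most `card ι` members. [folklore] -/
theorem card_le_of_const_indep_laurent [Fintype ι] (V : Submodule K (ι → K⸨X⸩))
    (L : (ι → K⸨X⸩) →ₗ[K⸨X⸩] (ι → K⸨X⸩)) (hV : ∀ Y ∈ V, dvecL Y = L Y) {m : ℕ}
    (Y : Fin m → ι → K⸨X⸩) (hYV : ∀ l, Y l ∈ V) (hK : LinearIndependent K Y) :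
    m ≤ Fintype.card ι := by
  have h := (linearIndependent_laurent_of_const V L hV Y hYV hK).fintype_card_le_finrank
  simpa [Module.finrank_pi] using h

end Descent

/-! ### 3. The solution space of a linear equation over `K⸨X⸩`; power-series bases -/

section Solutions

/-- The operator `u ↦ ∑_{k≤m} qₖ · Dᵏ u` on `K⸨X⸩`, as a `K`-linear map. [folklore] -/
def laurentOp (m : ℕ) (q : ℕ → K⸨X⸩) : K⸨X⸩ →ₗ[K] K⸨X⸩ where
  toFun u := ∑ k ∈ Finset.range (m + 1), q k * (⇑(LaurentSeries.derivative K))^[k] u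
  map_add' u v := by
    rw [← Finset.sum_add_distrib]
    refine Finset.sum_congr rfl fun k _ => ?_
    rw [← Module.End.pow_apply, ← Module.End.pow_apply, ← Module.End.pow_apply, map_add, mul_add]
  map_smul' a u := by
    rw [Finset.smul_sum]
    refine Finset.sum_congr rfl fun k _ => ?_
    rw [← Module.End.pow_apply, ← Module.End.pow_apply, map_smul, RingHom.id_apply,
      ← HahnSeries.C_mul_eq_smul, ← HahnSeries.C_mul_eq_smul]
    ring

omit [CharZero K] in
/-- Unfolding `laurentOp`. [folklore] -/
theorem laurentOp_apply (m : ℕ) (q : ℕ → K⸨X⸩) (u : K⸨X⸩) :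
    laurentOp m q u = ∑ k ∈ Finset.range (m + 1), q k * (⇑(LaurentSeries.derivative K))^[k] u := rfl

/-- The jet map `u ↦ (u, u′, …, u⁽ᵐ⁻¹⁾)`, `K`-linear. [folklore] -/
def laurentJetMap (m : ℕ) : K⸨X⸩ →ₗ[K] (Fin m → K⸨X⸩) :=
  LinearMap.pi fun j : Fin m => ((LaurentSeries.derivative K) ^ (j : ℕ) : K⸨X⸩ →ₗ[K] K⸨X⸩)

omit [CharZero K] in
/-- Unfolding `laurentJetMap`. [folklore] -/
theorem laurentJetMap_apply (m : ℕ) (u : K⸨X⸩) (j : Fin m) :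
    laurentJetMap m u j = (⇑(LaurentSeries.derivative K))^[(j : ℕ)] u := by
  simp [laurentJetMap, Module.End.pow_apply]

/-- **The `K`-space of solutions of an order-`m` linear equation over `K⸨X⸩` has dimension `≤ m`**,
in the form used below: if `y₁, …, yₘ` are `K`-linearly independent solutions of
`∑_{k≤m} qₖ Dᵏ u = 0` (`qₘ ≠ 0`), every solution lies in their `K`-span (Wronskian descent applied
to the jets `(u, u′, …, u⁽ᵐ⁻¹⁾)`). PROVED. [folklore] -/
theorem mem_span_of_laurentOp_eq_zero {m : ℕ} (q : ℕ → K⸨X⸩) (hqm : q m ≠ 0)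
    (y : Fin m → K⸨X⸩) (hy : ∀ i, laurentOp m q (y i) = 0) (hK : LinearIndependent K y)
    {z : K⸨X⸩} (hz : laurentOp m q z = 0) : z ∈ Submodule.span K (Set.range y) := by
  classical
  by_contra hzspan
  -- the `K`-space spanned by the `m + 1` solutions, and its jets
  set v : Fin (m + 1) → K⸨X⸩ := Fin.cons z y with hv
  set U : Submodule K K⸨X⸩ := Submodule.span K (Set.range v) with hU
  have hUsol : ∀ u ∈ U, laurentOp m q u = 0 := by
    intro u hu
    have : U ≤ LinearMap.ker (laurentOp m q) := by
      rw [hU, Submodule.span_le]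
      rintro _ ⟨i, rfl⟩
      refine Fin.cases ?_ (fun i => ?_) i
      · simpa [hv] using hz
      · simpa [hv] using hy i
    exact this hu
  set V : Submodule K (Fin m → K⸨X⸩) := U.map (laurentJetMap m) with hV
  -- the `K⸨X⸩`-linear map closing `V` under differentiation
  set Llast : (Fin m → K⸨X⸩) →ₗ[K⸨X⸩] K⸨X⸩ :=
    -((q m)⁻¹ • ∑ k : Fin m, q k • LinearMap.proj k) with hLlast
  set L : (Fin m → K⸨X⸩) →ₗ[K⸨X⸩] (Fin m → K⸨X⸩) :=
    LinearMap.pi fun j : Fin m =>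
      if h : (j : ℕ) + 1 < m then LinearMap.proj (⟨(j : ℕ) + 1, h⟩ : Fin m) else Llast with hL
  have hVclosed : ∀ Y ∈ V, dvecL Y = L Y := by
    intro Y hY
    obtain ⟨u, hu, rfl⟩ := Submodule.mem_map.mp hY
    have hsol := hUsol u hu
    funext j
    simp only [dvecL, laurentJetMap_apply, hL, LinearMap.pi_apply]
    split_ifs with h
    · simp only [LinearMap.coe_proj, Function.eval, laurentJetMap_apply]
      rw [← Function.iterate_succ_apply' (⇑(LaurentSeries.derivative K))]
    · -- last component: use the equation
      have hjm : (j : ℕ) + 1 = m := by omega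
      simp only [hLlast, LinearMap.neg_apply, LinearMap.smul_apply, LinearMap.coe_sum,
        Finset.sum_apply, LinearMap.coe_proj, Function.eval, laurentJetMap_apply, smul_eq_mul]
      rw [laurentOp_apply, Finset.sum_range_succ, Finset.sum_range] at hsol
      rw [← Function.iterate_succ_apply' (⇑(LaurentSeries.derivative K))]
      show (⇑(LaurentSeries.derivative K))^[(j : ℕ) + 1] u = _
      rw [hjm]
      have : q m * (⇑(LaurentSeries.derivative K))^[m] u =
          -∑ k : Fin m, q k * (⇑(LaurentSeries.derivative K))^[(k : ℕ)] u := by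
        linear_combination hsol
      calc (⇑(LaurentSeries.derivative K))^[m] u
          = (q m)⁻¹ * (q m * (⇑(LaurentSeries.derivative K))^[m] u) := by
            rw [← mul_assoc, inv_mul_cancel₀ hqm, one_mul]
        _ = _ := by rw [this]; ring
  -- the `m + 1` jets are `K`-independent: contradiction with the descent bound
  have hind : LinearIndependent K v := by
    rw [hv]; exact linearIndependent_finCons.2 ⟨hK, hzspan⟩
  have hker : LinearMap.ker (laurentJetMap m ∘ₗ U.subtype) = ⊥ := by
    rcases Nat.eq_zero_or_pos m with hm | hm
    · -- `m = 0`: then `q 0 ≠ 0` kills every solution, so `z = 0 ∈ span`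
      exfalso
      subst hm
      apply hzspan
      have : z = 0 := by
        have h0 := hz
        rw [laurentOp_apply, Finset.sum_range_one, Function.iterate_zero, id_eq] at h0
        exact (mul_eq_zero.mp h0).resolve_left hqm
      rw [this]; exact Submodule.zero_mem _
    · rw [LinearMap.ker_eq_bot']
      intro u hu
      have := congr_fun hu ⟨0, hm⟩
      simp only [LinearMap.coe_comp, Submodule.coe_subtype, Function.comp_apply, laurentJetMap_apply,
        Function.iterate_zero, id_eq, Pi.zero_apply] at this
      exact Subtype.ext this
  -- the family inside `U`
  set fam : Fin (m + 1) → U := fun i => ⟨v i, Submodule.subset_span (Set.mem_range_self i)⟩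
    with hfam
  have hfamind : LinearIndependent K fam := by
    refine (LinearIndependent.of_comp U.subtype ?_)
    have : ⇑U.subtype ∘ fam = v := funext fun i => rfl
    rw [this]
    exact hind
  have hjets : LinearIndependent K ((laurentJetMap m ∘ₗ U.subtype) ∘ fam) :=
    hfamind.map' _ hker
  have hle := card_le_of_const_indep_laurent V L hVclosed ((laurentJetMap m ∘ₗ U.subtype) ∘ fam)
    (fun l => Submodule.mem_map.mpr ⟨(fam l : K⸨X⸩), (fam l).2, rfl⟩) hjets
  simp at hle

/-- **Power-series bases force power-series solutions.** If an order-`m` equation over `K⸨X⸩`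
(`qₘ ≠ 0`) has `m` solutions in `K⟦X⟧` which are linearly independent over `K`, then every
Laurent-series solution is a power series (it is a `K`-combination of them): the formal content of
"a basis of holomorphic solutions at a point rules out solutions with a pole there". PROVED.
[folklore] -/
theorem exists_powerSeries_of_laurentOp_eq_zero {m : ℕ} (q : ℕ → K⸨X⸩) (hqm : q m ≠ 0)
    (y : Fin m → PowerSeries K) (hy : ∀ i, laurentOp m q (y i : K⸨X⸩) = 0)
    (hK : LinearIndependent K y) {z : K⸨X⸩} (hz : laurentOp m q z = 0) :
    ∃ z₀ : PowerSeries K, (z₀ : K⸨X⸩) = z := by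
  -- the coercion `K⟦X⟧ → K⸨X⸩` as a `K`-linear map
  set coeL : PowerSeries K →ₗ[K] K⸨X⸩ :=
    { toFun := fun f => (f : K⸨X⸩)
      map_add' := fun f g => _root_.PowerSeries.coe_add f g
      map_smul' := fun a f => by simp } with hcoeL
  have hcoeL_apply : ∀ f, coeL f = (f : K⸨X⸩) := fun f => rfl
  have hK' : LinearIndependent K (fun i => (y i : K⸨X⸩)) := by
    have := hK.map' coeL (LinearMap.ker_eq_bot_of_injective
      (fun f g h => HahnSeries.ofPowerSeries_injective (by simpa [hcoeL_apply] using h)))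
    exact this
  have hmem := mem_span_of_laurentOp_eq_zero q hqm (fun i => (y i : K⸨X⸩)) hy hK' hz
  have hrange : (Set.range fun i => ((y i : PowerSeries K) : K⸨X⸩)) = coeL '' Set.range y := by
    ext w
    simp only [Set.mem_range, Set.mem_image, hcoeL_apply]
    constructor
    · rintro ⟨i, rfl⟩; exact ⟨y i, ⟨i, rfl⟩, rfl⟩
    · rintro ⟨_, ⟨i, rfl⟩, rfl⟩; exact ⟨i, rfl⟩
  rw [hrange, Submodule.span_image] at hmem
  obtain ⟨z₀, -, hz₀⟩ := Submodule.mem_map.mp hmem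
  exact ⟨z₀, hz₀⟩

end Solutions

end Literature.RingTheory.PowerSeries

end
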